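import Summits.Ventures.KdS.SpinFlipFrobenius
import Summits.Ventures.KdS.RouteWGaugeGlue
import Literature.Analysis.ODE.HeunMobius
import HarnessLib

/-!
# Venture KdS — analysis toolkit for the Teukolsky–Starobinsky transfer (VI): the Möbius image of
# `x^{1−γ}(z_r−x)^{1−ε}·r(x)` is a Frobenius-polynomial function; mode data of such functions

HONEST FRAMING (venture `Summits/Ventures/KdS`, cell `pub-kds`; LIT-1 g22 under lead ruling A86):
general-Heun bookkeeping, nothing about Kerr–de Sitter. For a polynomial `r` with `deg r ≤ D` and
exponents with `γ + ε − 2 − σ = D`, the Möbius–Euler image `z^{−σ}·y(z_r(z−1)/z)`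
(`GeneralHeun.mobiusV`) of `y(x) = x^{1−γ}(z_r−x)^{1−ε}·r(x)` is
`k_{γ+ε−2}(z_r)·(w−1)^{1−γ}·A(w−1)` with the explicit polynomial
`A(T) = Σ_{i≤D} r_i z_r^i T^i (T+1)^{D−i}` of degree `≤ D` (`shiftPoly`, `mobiusV_eq_cpow_mul_eval`),
i.e. a Frobenius-polynomial function `Σ_k a_k (w−1)^{ρ+k}` of `SpinFlipFrobenius`
(`cpow_mul_eval_eq_cpowSum`); and a Frobenius-polynomial solution on `(1, z₂)` is Euler-gauge Heun
mode data in the sense of `RouteW.HeunModeData` (`heunModeData_cpowSum`: branch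
`(w−1)^μ·(polynomial)` at `1`, smooth across `z₂`). Used by `RouteWSpinFlipStrata.lean`.
0 cited facts, no `sorry`.
-/

noncomputable section

open Set Complex Filter Topology Finset Polynomial

namespace Summit.Ventures.KdS

namespace SpinFlipTS

open Literature.Analysis.ODE Literature.Analysis.ODE.GeneralHeun

/-! ### The Möbius image of `x^{1−γ}(z_r−x)^{1−ε}·r(x)` is a Frobenius-polynomial function -/

/-- The polynomial `A(T) = Σ_{i≤D} r_i z_r^i T^i (T+1)^{D−i}`:
`w^D · r(z_r(w−1)/w) = A(w−1)`. -/
def shiftPoly (zr : ℝ) (D : ℕ) (r : Polynomial ℂ) : Polynomial ℂ :=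
  ∑ i ∈ range (D + 1), C (r.coeff i * (zr : ℂ) ^ i) * X ^ i * (X + C 1) ^ (D - i)

/-- `deg A ≤ D`. -/
theorem shiftPoly_natDegree_le (zr : ℝ) (D : ℕ) (r : Polynomial ℂ) :
    (shiftPoly zr D r).natDegree ≤ D := by
  unfold shiftPoly
  refine natDegree_sum_le_of_forall_le _ _ fun i hi => ?_
  have hiD : i ≤ D := Nat.lt_succ_iff.mp (mem_range.mp hi)
  calc (C (r.coeff i * (zr : ℂ) ^ i) * X ^ i * (X + C 1) ^ (D - i)).natDegree
      ≤ (C (r.coeff i * (zr : ℂ) ^ i) * X ^ i).natDegree + ((X + C (1 : ℂ)) ^ (D - i)).natDegree :=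
        natDegree_mul_le
    _ ≤ i + (D - i) * (X + C (1 : ℂ)).natDegree := by
        gcongr
        · exact natDegree_C_mul_X_pow_le _ _
        · exact natDegree_pow_le
    _ = D := by rw [natDegree_X_add_C, mul_one]; omega

/-- `w^D · r(z_r(w−1)/w) = A(w−1)` for `w ≠ 0` when `deg r ≤ D`. -/
theorem shiftPoly_eval {zr : ℝ} {D : ℕ} {r : Polynomial ℂ} (hr : r.natDegree ≤ D) {w : ℝ}
    (hw : w ≠ 0) :
    (w : ℂ) ^ D * r.eval ((mobiusX zr w : ℝ) : ℂ) = (shiftPoly zr D r).eval ((w : ℂ) - 1) := by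
  have hw' : (w : ℂ) ≠ 0 := by exact_mod_cast hw
  have hx : ((mobiusX zr w : ℝ) : ℂ) = (zr : ℂ) * ((w : ℂ) - 1) / (w : ℂ) := by
    unfold mobiusX; push_cast; ring
  rw [eval_eq_sum_range' (lt_of_le_of_lt hr (Nat.lt_succ_self D)), hx, mul_sum]
  unfold shiftPoly
  rw [eval_finsetSum]
  refine sum_congr rfl fun i hi => ?_
  obtain ⟨k, hk⟩ := Nat.exists_eq_add_of_le (Nat.lt_succ_iff.mp (mem_range.mp hi))
  rw [hk, Nat.add_sub_cancel_left]
  simp only [eval_mul, eval_C, eval_pow, eval_X, eval_add, sub_add_cancel]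
  rw [div_pow, mul_pow, pow_add]
  field_simp

/-- `k_c(z_r/w) = k_c(z_r)·k_{−c}(w)` for positive reals. -/
theorem eulerKernel_div (c : ℂ) {zr w : ℝ} (hzr : 0 < zr) (hw : 0 < w) :
    eulerKernel c (zr / w) = eulerKernel c zr * eulerKernel (-c) w := by
  unfold eulerKernel
  rw [Real.log_div hzr.ne' hw.ne', ← Complex.exp_add]
  push_cast
  ring_nf

/-- **Euler-gauge form.** If `y(x) = x^{1−γ}(z_r−x)^{1−ε}·r(x)` on `(0,1)` with `deg r ≤ D` and
`γ + ε − 2 − σ = D`, then for `w > 1` with `z_r(w−1)/w ∈ (0,1)`: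
`z^{−σ}y(z_r(w−1)/w) = k_{γ+ε−2}(z_r) · (w−1)^{1−γ} · A(w−1)`. -/
theorem mobiusV_eq_cpow_mul_eval {zr : ℝ} (hzr : 0 < zr) {σ γ ε : ℂ} {D : ℕ} {r : Polynomial ℂ}
    (hr : r.natDegree ≤ D) (hκ : γ + ε - 2 - σ = D) {y : ℝ → ℂ}
    (hy : ∀ x ∈ Ioo (0 : ℝ) 1,
      y x = (x : ℂ) ^ (1 - γ) * ((zr - x : ℝ) : ℂ) ^ (1 - ε) * r.eval (x : ℂ))
    {w : ℝ} (hw : 1 < w) (hx : mobiusX zr w ∈ Ioo (0 : ℝ) 1) :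
    mobiusV zr σ y w = eulerKernel (γ + ε - 2) zr *
      (((w - 1 : ℝ) : ℂ) ^ (1 - γ) * (shiftPoly zr D r).eval ((w : ℂ) - 1)) := by
  have hw0 : 0 < w := by linarith
  have hq : 0 < zr / w := div_pos hzr hw0
  have hxe : mobiusX zr w = (w - 1) * (zr / w) := by unfold mobiusX; field_simp
  have hzx : zr - mobiusX zr w = zr / w := by unfold mobiusX; field_simp; ring
  have hq' : ((zr / w : ℝ) : ℂ) ≠ 0 := by exact_mod_cast hq.ne'
  have hxpow : ((mobiusX zr w : ℝ) : ℂ) ^ (1 - γ) =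
      ((w - 1 : ℝ) : ℂ) ^ (1 - γ) * ((zr / w : ℝ) : ℂ) ^ (1 - γ) := by
    rw [hxe, Complex.ofReal_mul, Complex.mul_cpow_ofReal_nonneg (by linarith) hq.le]
  simp only [mobiusV]
  rw [hy _ hx, hzx, hxpow]
  -- collect the powers of `z_r/w`
  have h1 : ((zr / w : ℝ) : ℂ) ^ (1 - γ) * ((zr / w : ℝ) : ℂ) ^ (1 - ε) =
      eulerKernel (γ + ε - 2) zr * eulerKernel (-(γ + ε - 2)) w := by
    rw [← Complex.cpow_add _ _ hq', ← eulerKernel_div _ hzr hw0, eulerKernel_eq_cpow _ hq]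
    push_cast
    ring_nf
  have h2 : eulerKernel σ w * eulerKernel (-(γ + ε - 2)) w = (w : ℂ) ^ D := by
    rw [RouteW.eulerKernel_mul, show σ + -(γ + ε - 2) = -(D : ℂ) by linear_combination -hκ,
      RouteW.eulerKernel_neg_eq_cpow _ hw0, Complex.cpow_natCast]
  have h3 := shiftPoly_eval (zr := zr) hr hw0.ne'
  calc eulerKernel σ w * (((w - 1 : ℝ) : ℂ) ^ (1 - γ) * ((zr / w : ℝ) : ℂ) ^ (1 - γ) *
        ((zr / w : ℝ) : ℂ) ^ (1 - ε) * r.eval ((mobiusX zr w : ℝ) : ℂ))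
      = ((w - 1 : ℝ) : ℂ) ^ (1 - γ) *
          (((zr / w : ℝ) : ℂ) ^ (1 - γ) * ((zr / w : ℝ) : ℂ) ^ (1 - ε)) *
          (eulerKernel σ w * r.eval ((mobiusX zr w : ℝ) : ℂ)) := by ring
    _ = ((w - 1 : ℝ) : ℂ) ^ (1 - γ) * (eulerKernel (γ + ε - 2) zr) *
          ((eulerKernel σ w * eulerKernel (-(γ + ε - 2)) w) * r.eval ((mobiusX zr w : ℝ) : ℂ)) := by
        rw [h1]; ring
    _ = eulerKernel (γ + ε - 2) zr *
          (((w - 1 : ℝ) : ℂ) ^ (1 - γ) * (shiftPoly zr D r).eval ((w : ℂ) - 1)) := by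
        rw [h2, h3]; ring

/-- The Frobenius-polynomial function of a polynomial: for `w > 1`,
`c·(w−1)^ρ·A(w−1) = Σ_{k≤D} (c·A_k)(w−1)^{ρ+k}` when `deg A ≤ D`. -/
theorem cpow_mul_eval_eq_cpowSum {A : Polynomial ℂ} {D : ℕ} (hA : A.natDegree ≤ D) (c ρ : ℂ)
    {w : ℝ} (hw : 1 < w) :
    c * (((w - 1 : ℝ) : ℂ) ^ ρ * A.eval ((w : ℂ) - 1)) =
      cpowSum ρ (fun k => c * A.coeff k) (D + 1) w := by
  rw [cpowSum_eq ρ _ (D + 1) hw, eval_eq_sum_range' (lt_of_le_of_lt hA (Nat.lt_succ_self D)),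
    mul_sum, mul_sum, mul_sum]
  exact sum_congr rfl fun k _ => by ring

/-- Mode data of a Frobenius-polynomial solution on `(1, z₂)`: branch `(w−1)^μ·(polynomial)` at
`1`, smooth across `z₂`. -/
theorem heunModeData_cpowSum {z₂ : ℝ} (hz₂ : 1 < z₂) {α β γ δ ε q μ : ℂ} {c : ℕ → ℂ} {K : ℕ}
    (hsol : IsSolutionOn (z₂ : ℂ) α β γ δ ε q (Ioo 1 z₂) (cpowSum μ c K)) :
    RouteW.HeunModeData z₂ α β γ δ ε q μ (cpowSum μ c K) := by
  have hpoly : ContDiff ℝ ((⊤ : ℕ∞) : WithTop ℕ∞)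
      (fun w : ℝ => ∑ k ∈ range K, c k * ((w : ℂ) - 1) ^ k) :=
    ContDiff.sum fun k _ => contDiff_const.mul
      ((Complex.ofRealCLM.contDiff.sub contDiff_const).pow k)
  have hsub : Ioo (z₂ - (z₂ - 1) / 2) (z₂ + (z₂ - 1) / 2) ⊆ Ioi 1 := fun w hw =>
    Set.mem_Ioi.mpr (by have := hw.1; linarith)
  exact ⟨hsol, ⟨1, one_pos, fun w => ∑ k ∈ range K, c k * ((w : ℂ) - 1) ^ k, hpoly.contDiffOn,
    fun w hw => cpowSum_eq μ c K hw.1⟩, ⟨(z₂ - 1) / 2, by linarith, cpowSum μ c K,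
    (contDiffOn_cpowSum μ c K).mono hsub, fun w _ => rfl⟩⟩

end SpinFlipTS

end Summit.Ventures.KdS
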